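import Summits.Ventures.CertifiedManyBodySolver.Certificates.HubbardSquare_n7o8_tpbox_p1o5_p3o10_thermal_axis_C2markov3x3_j273931
import Summits.Ventures.CertifiedManyBodySolver.Certificates.HubbardSquare_n9o8_tpm1o4_thermal_axis_PH_C2markov3x3_j273931
import Literature.MathematicalPhysics.QuantumLattice.TorusLimitParticleHoleWordPullback
import Literature.MathematicalPhysics.QuantumLattice.HubbardTTPrimeBoxTransport
import HarnessLib

/-!
# Ventures/CertifiedManyBodySolver — ELECTRON-DOPED `t'`-FACE cells: `t' ∈ [−3/10, −1/5]` at `(U, n) = (8, 9/8)` (⊇ the NCCO #20 face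
# `t'/t ∈ [−0.29, −0.19]` at its central filling), `β ∈ {1/2, …, 3}` and colder, by PARTICLE–HOLE from the image-side `t'`-box cells

HONEST FRAMING: first certified bounds; not a superconductivity verdict; every number certified or labelled float.
WHAT THIS IS NOT: not a phase sentence; not of record until the mbsolver LEAD pen + referee sign; energy WINDOWS for the tree's THERMAL object of the
ELECTRON-DOPED `t–t'` model (torus limits of the canonical sector Gibbs states of `hubbardTorusTT' L 1 s 8`, `s ∈ [−3/10, −1/5]`, on `N↑ = N↓ = ⌊9L²/16⌋`)
along `Ls → ∞` with `4 ∣ Ls j` eventually (flag «PH-transported, even-tori subsequence», cell ruling R-co); UPPER edges CONDITIONAL on the nodes of the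
image file `HubbardSquare_n7o8_tpbox_p1o5_p3o10_thermal_axis_C2markov3x3_j273931` (p2's `cert_c2sector_tp1o4_3x3_<β>_j273931` + eng-2's `cert_feC1_3x2_*`),
LOWER edges kernel; no new certificate; 0 core-h.

MECHANISM: for `s ∈ [−3/10, −1/5]` the image hopping `−s ∈ [1/5, 3/10]`; the image `t'`-box cap `e_{Φ(1,−s,8)} ≤ X_β` over the canonical class at
`(1, −s, 8, 7/8, β' ≥ β)` (every `Ls'`) pulls back by the instance form `IsTorusLimitOfMixture.meanEnergy_le_of_forall_image_cap` (this seat,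
`TorusLimitParticleHoleWordPullback` §3) to `e_{Φ(1,s,8)}(ω) ≤ X_β − 8·(1 − 9/8) = X_β + 1`. LOWER edge: `e(1, s, U, 9/8) = e(1, −s, U, 7/8) + U/8 ≥
(e(1, 1/4, U, 7/8) − 1.6212·|−s − 1/4|) + U/8 ≥ −1.7845478090 + U/8` (kernel Fermi-sea tangent row at `+1/4` + the kernel `t'`-Lipschitz bound
`abs_energyDensityTT'_sub_tPrime_le_decimal` + particle–hole), and thermal ≥ ground. HENCE for every `s ∈ [−3/10, −1/5]`, every torus limit at `β' ≥ β` along `4 ∣ L`: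
`β = 1/2` (T = 2t): `e ∈ [−0.7845478090, 1.5596278741]` · `β = 3/4` (T = 4t/3): `e ∈ [−0.7845478090, 1.2736116921]` · `β = 1` (T = t): `e ∈ [−0.7845478090, 1.1313334043]` · `β = 5/4` (T = 4t/5): `e ∈ [−0.7845478090, 1.0172886318]` · `β = 3/2` (T = 2t/3): `e ∈ [−0.7845478090, 0.9421801550]` · `β = 2` (T = t/2): `e ∈ [−0.7845478090, 0.8464499976]` · `β = 3` (T = t/3): `e ∈ [−0.7845478090, 0.7498266510]`.
(At the face centre `s = −1/4` the point files are tighter: `[−0.7034878090, c_β + 1]`.) Strength (upper edges) = the named nodes ∧ kernel theorems; retracted with any of them.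
[cite: LiebWuPhysicaA2003, §1 eq. (3)] [cite: Israel1979, Lemma II.3.1] [cite: Israel1979, Thm. I.3.4] [cite: Lieb1973, §V (5.2)–(5.4)] [cite: PoulinHastings2011, eqs. (3)–(8)]
[cite: Ruelle1969, §3.4] [cite: LiebLoss1993, §8, Theorem 8.2]
Seat prover-hubbard-downfold-unc-2-g8, 2026-08-27; zero solves, zero kit.
-/

noncomputable section

namespace Summit.Ventures.CertifiedManyBodySolver.Certificates

open Literature.MathematicalPhysics.QuantumLattice
open Literature.MathematicalPhysics.QuantumLattice.ThermodynamicLimit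
open Literature.MathematicalPhysics.QuantumLattice.InfVolFermionState
open Literature.MathematicalPhysics.QuantumLattice.AndersonCluster
open Literature.Probability.LatticeModels
open _root_.Filter
open scoped ComplexOrder

/-- **Electron-doped ground-state floor on the `t'`-face**, every `U ≥ 0`, every `s ∈ [−3/10, −1/5]`: `e(1, s, U, 9/8) ≥ −1.7845478090 + U/8`
(Fermi sea at the image anchor `(1/4, 7/8)`, `t'`-Lipschitz `1.6212·|−s − 1/4| ≤ 1.6212/20`, particle–hole `+U/8`; kernel, no node).
[cite: LiebLoss1993, §8, Theorem 8.2] [cite: Israel1979, Thm. I.3.4] [cite: LiebWuPhysicaA2003, §1 eq. (3)] -/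
theorem ground_n9o8_tpbox_floor_PH {U : ℝ} (hU : 0 ≤ U) {s : ℝ} (hs : s ∈ Set.Icc (-3 / 10 : ℝ) (-1 / 5)) :
    (-1.7845478090 : ℝ) + U * (1 / 8) ≤ energyDensityTT' 1 s U (9 / 8) := by
  have hanchor := ground_n7o8_tp1o4_floor_fermiSea hU
  have hlip := abs_energyDensityTT'_sub_tPrime_le_decimal 1 hU (n := 7 / 8) (by norm_num) (by norm_num) (-s) (1 / 4)
  have habs : |(-s) - 1 / 4| ≤ 1 / 20 := abs_le.2 ⟨by linarith [hs.1, hs.2], by linarith [hs.1, hs.2]⟩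
  have himg : (-1.7845478090 : ℝ) ≤ energyDensityTT' 1 (-s) U (2 - 9 / 8) := by
    rw [show (2 - 9 / 8 : ℝ) = 7 / 8 by norm_num]
    have h1 := (abs_le.1 (hlip.trans (mul_le_mul_of_nonneg_left habs (by norm_num)))).1
    linarith
  have h := energyDensityTT'_ge_of_particleHole_image 1 s hU (n := 9 / 8) (by norm_num) (by norm_num) himg
  linarith

/-- **LOWER EDGE on the `t'`-face** (every `β`, every `Ls`, every `U ≥ 0`, every `s ∈ [−3/10, −1/5]`; no node): `−1.7845478090 + U/8 ≤ e(ω)` for every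
torus limit of the canonical class at `(1, s, U, 9/8, β)`. [cite: Ruelle1969, §3.4] [cite: LiebWuPhysicaA2003, §1 eq. (3)] -/
theorem thermal_n9o8_tpbox_lower {β U : ℝ} (hU : 0 ≤ U) {s : ℝ} (hs : s ∈ Set.Icc (-3 / 10 : ℝ) (-1 / 5)) {ω : InfVolFermionState 2}
    {Ls : ℕ → ℕ} (hLs : Tendsto Ls atTop atTop)
    (h : ω.IsTorusLimitOfMixture (sectorGibbsCount (9 / 8)) (fun L => sectorGibbsWeightTT' β 1 s U (9 / 8) L)
      (fun L => sectorGibbsVectorTT' 1 s U (9 / 8) L) Ls) :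
    (-1.7845478090 : ℝ) + U * (1 / 8) ≤ ω.meanEnergy (hubbardTTPrimeFermionInteraction 1 s U) 1 :=
  (ground_n9o8_tpbox_floor_PH hU hs).trans
    (h.energyDensityTT'_le_meanEnergy_of_sectorGibbs 1 s U (n := 9 / 8) (by norm_num) (by norm_num) β hLs s hU)

/-- **ELECTRON-DOPED `t'`-face cap, `β' ≥ 1/2`** (T = 2t and colder): for every `s ∈ [−3/10, −1/5]` and every torus limit of the canonical class at
`(1, s, 8, 9/8, β')` along `Ls` with `4 ∣ Ls j` eventually, `e_{Φ(1,s,8)}(ω) ≤ 1.5596278741` (image `t'`-box cap `0.5596278741` + 1).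
Strength = C2(cert_c2sector_tp1o4_3x3_b1o2_j273931) ∧ C1(cert_feC1_3x2_b1o8_j263703) ∧ kernel theorems. [cite: LiebWuPhysicaA2003, §1 eq. (3)] [cite: Israel1979, Lemma II.3.1] -/
theorem thermal_n9o8_tpbox_upper_b1o2_PH_of_le (hC2 : cert_c2sector_tp1o4_3x3_b1o2_j273931) (hC1 : cert_feC1_3x2_b1o8_j263703) {s : ℝ}
    (hs : s ∈ Set.Icc (-3 / 10 : ℝ) (-1 / 5)) {β : ℝ} (hle : (1 / 2 : ℝ) ≤ β) {ω : InfVolFermionState 2} {Ls : ℕ → ℕ}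
    (hLs : Tendsto Ls atTop atTop) (h4 : ∀ᶠ j in atTop, 4 ∣ Ls j)
    (h : ω.IsTorusLimitOfMixture (sectorGibbsCount (9 / 8)) (fun L => sectorGibbsWeightTT' β 1 s 8 (9 / 8) L)
      (fun L => sectorGibbsVectorTT' 1 s 8 (9 / 8) L) Ls) :
    ω.meanEnergy (hubbardTTPrimeFermionInteraction 1 s 8) 1 ≤ (1.5596278741 : ℝ) := by
  have heven : ∀ᶠ j in atTop, Even (Ls j) :=
    h4.mono fun j hj => even_iff_two_dvd.2 (dvd_trans (by norm_num) hj)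
  have hadd : ∀ᶠ j in atTop, halfRectN (7 / 8) (Ls j) + halfRectN (9 / 8) (Ls j) = Ls j ^ 2 :=
    h4.mono fun j hj => by
      have h' := halfRectN_compl_nine_eighths hj
      rwa [show (2 - 9 / 8 : ℝ) = 7 / 8 by norm_num] at h'
  have hs' : -s ∈ Set.Icc (1 / 5 : ℝ) (3 / 10) := ⟨by linarith [hs.2], by linarith [hs.1]⟩
  have hmain := h.meanEnergy_le_of_forall_image_cap β 1 s 8 (s' := -s) (n' := 7 / 8) rfl (by norm_num) (by norm_num) (by norm_num)
    (fun Ls' ω' hLs' hω' => image_tpbox_p1o5_p3o10_upper_b1o2_of_le hC2 hC1 hs' hle hLs' hω') hLs heven hadd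
  linarith

/-- **ELECTRON-DOPED `t'`-face WINDOW, `β' ≥ 1/2`**: `e ∈ [−0.7845478090, 1.5596278741]` (lower edge kernel, upper edge conditional).
[cite: LiebWuPhysicaA2003, §1 eq. (3)] [cite: Ruelle1969, §3.4] -/
theorem thermal_n9o8_tpbox_window_b1o2_PH_of_le (hC2 : cert_c2sector_tp1o4_3x3_b1o2_j273931) (hC1 : cert_feC1_3x2_b1o8_j263703) {s : ℝ}
    (hs : s ∈ Set.Icc (-3 / 10 : ℝ) (-1 / 5)) {β : ℝ} (hle : (1 / 2 : ℝ) ≤ β) {ω : InfVolFermionState 2} {Ls : ℕ → ℕ}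
    (hLs : Tendsto Ls atTop atTop) (h4 : ∀ᶠ j in atTop, 4 ∣ Ls j)
    (h : ω.IsTorusLimitOfMixture (sectorGibbsCount (9 / 8)) (fun L => sectorGibbsWeightTT' β 1 s 8 (9 / 8) L)
      (fun L => sectorGibbsVectorTT' 1 s 8 (9 / 8) L) Ls) :
    ω.meanEnergy (hubbardTTPrimeFermionInteraction 1 s 8) 1 ∈ Set.Icc (-0.7845478090 : ℝ) 1.5596278741 := by
  refine ⟨?_, thermal_n9o8_tpbox_upper_b1o2_PH_of_le hC2 hC1 hs hle hLs h4 h⟩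
  have hl := thermal_n9o8_tpbox_lower (U := 8) (by norm_num) hs hLs h
  linarith

/-- **ELECTRON-DOPED `t'`-face cap, `β' ≥ 3/4`** (T = 4t/3 and colder): for every `s ∈ [−3/10, −1/5]` and every torus limit of the canonical class at
`(1, s, 8, 9/8, β')` along `Ls` with `4 ∣ Ls j` eventually, `e_{Φ(1,s,8)}(ω) ≤ 1.2736116921` (image `t'`-box cap `0.2736116921` + 1).
Strength = C2(cert_c2sector_tp1o4_3x3_b3o4_j273931) ∧ C1(cert_feC1_3x2_b1o8_j263703) ∧ kernel theorems. [cite: LiebWuPhysicaA2003, §1 eq. (3)] [cite: Israel1979, Lemma II.3.1] -/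
theorem thermal_n9o8_tpbox_upper_b3o4_PH_of_le (hC2 : cert_c2sector_tp1o4_3x3_b3o4_j273931) (hC1 : cert_feC1_3x2_b1o8_j263703) {s : ℝ}
    (hs : s ∈ Set.Icc (-3 / 10 : ℝ) (-1 / 5)) {β : ℝ} (hle : (3 / 4 : ℝ) ≤ β) {ω : InfVolFermionState 2} {Ls : ℕ → ℕ}
    (hLs : Tendsto Ls atTop atTop) (h4 : ∀ᶠ j in atTop, 4 ∣ Ls j)
    (h : ω.IsTorusLimitOfMixture (sectorGibbsCount (9 / 8)) (fun L => sectorGibbsWeightTT' β 1 s 8 (9 / 8) L)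
      (fun L => sectorGibbsVectorTT' 1 s 8 (9 / 8) L) Ls) :
    ω.meanEnergy (hubbardTTPrimeFermionInteraction 1 s 8) 1 ≤ (1.2736116921 : ℝ) := by
  have heven : ∀ᶠ j in atTop, Even (Ls j) :=
    h4.mono fun j hj => even_iff_two_dvd.2 (dvd_trans (by norm_num) hj)
  have hadd : ∀ᶠ j in atTop, halfRectN (7 / 8) (Ls j) + halfRectN (9 / 8) (Ls j) = Ls j ^ 2 :=
    h4.mono fun j hj => by
      have h' := halfRectN_compl_nine_eighths hj
      rwa [show (2 - 9 / 8 : ℝ) = 7 / 8 by norm_num] at h'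
  have hs' : -s ∈ Set.Icc (1 / 5 : ℝ) (3 / 10) := ⟨by linarith [hs.2], by linarith [hs.1]⟩
  have hmain := h.meanEnergy_le_of_forall_image_cap β 1 s 8 (s' := -s) (n' := 7 / 8) rfl (by norm_num) (by norm_num) (by norm_num)
    (fun Ls' ω' hLs' hω' => image_tpbox_p1o5_p3o10_upper_b3o4_of_le hC2 hC1 hs' hle hLs' hω') hLs heven hadd
  linarith

/-- **ELECTRON-DOPED `t'`-face WINDOW, `β' ≥ 3/4`**: `e ∈ [−0.7845478090, 1.2736116921]` (lower edge kernel, upper edge conditional).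
[cite: LiebWuPhysicaA2003, §1 eq. (3)] [cite: Ruelle1969, §3.4] -/
theorem thermal_n9o8_tpbox_window_b3o4_PH_of_le (hC2 : cert_c2sector_tp1o4_3x3_b3o4_j273931) (hC1 : cert_feC1_3x2_b1o8_j263703) {s : ℝ}
    (hs : s ∈ Set.Icc (-3 / 10 : ℝ) (-1 / 5)) {β : ℝ} (hle : (3 / 4 : ℝ) ≤ β) {ω : InfVolFermionState 2} {Ls : ℕ → ℕ}
    (hLs : Tendsto Ls atTop atTop) (h4 : ∀ᶠ j in atTop, 4 ∣ Ls j)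
    (h : ω.IsTorusLimitOfMixture (sectorGibbsCount (9 / 8)) (fun L => sectorGibbsWeightTT' β 1 s 8 (9 / 8) L)
      (fun L => sectorGibbsVectorTT' 1 s 8 (9 / 8) L) Ls) :
    ω.meanEnergy (hubbardTTPrimeFermionInteraction 1 s 8) 1 ∈ Set.Icc (-0.7845478090 : ℝ) 1.2736116921 := by
  refine ⟨?_, thermal_n9o8_tpbox_upper_b3o4_PH_of_le hC2 hC1 hs hle hLs h4 h⟩
  have hl := thermal_n9o8_tpbox_lower (U := 8) (by norm_num) hs hLs h
  linarith

/-- **ELECTRON-DOPED `t'`-face cap, `β' ≥ 1`** (T = t and colder): for every `s ∈ [−3/10, −1/5]` and every torus limit of the canonical class at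
`(1, s, 8, 9/8, β')` along `Ls` with `4 ∣ Ls j` eventually, `e_{Φ(1,s,8)}(ω) ≤ 1.1313334043` (image `t'`-box cap `0.1313334043` + 1).
Strength = C2(cert_c2sector_tp1o4_3x3_b1_j273931) ∧ C1(cert_feC1_3x2_b1o4_j262363) ∧ kernel theorems. [cite: LiebWuPhysicaA2003, §1 eq. (3)] [cite: Israel1979, Lemma II.3.1] -/
theorem thermal_n9o8_tpbox_upper_b1_PH_of_le (hC2 : cert_c2sector_tp1o4_3x3_b1_j273931) (hC1 : cert_feC1_3x2_b1o4_j262363) {s : ℝ}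
    (hs : s ∈ Set.Icc (-3 / 10 : ℝ) (-1 / 5)) {β : ℝ} (hle : (1 : ℝ) ≤ β) {ω : InfVolFermionState 2} {Ls : ℕ → ℕ}
    (hLs : Tendsto Ls atTop atTop) (h4 : ∀ᶠ j in atTop, 4 ∣ Ls j)
    (h : ω.IsTorusLimitOfMixture (sectorGibbsCount (9 / 8)) (fun L => sectorGibbsWeightTT' β 1 s 8 (9 / 8) L)
      (fun L => sectorGibbsVectorTT' 1 s 8 (9 / 8) L) Ls) :
    ω.meanEnergy (hubbardTTPrimeFermionInteraction 1 s 8) 1 ≤ (1.1313334043 : ℝ) := by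
  have heven : ∀ᶠ j in atTop, Even (Ls j) :=
    h4.mono fun j hj => even_iff_two_dvd.2 (dvd_trans (by norm_num) hj)
  have hadd : ∀ᶠ j in atTop, halfRectN (7 / 8) (Ls j) + halfRectN (9 / 8) (Ls j) = Ls j ^ 2 :=
    h4.mono fun j hj => by
      have h' := halfRectN_compl_nine_eighths hj
      rwa [show (2 - 9 / 8 : ℝ) = 7 / 8 by norm_num] at h'
  have hs' : -s ∈ Set.Icc (1 / 5 : ℝ) (3 / 10) := ⟨by linarith [hs.2], by linarith [hs.1]⟩
  have hmain := h.meanEnergy_le_of_forall_image_cap β 1 s 8 (s' := -s) (n' := 7 / 8) rfl (by norm_num) (by norm_num) (by norm_num)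
    (fun Ls' ω' hLs' hω' => image_tpbox_p1o5_p3o10_upper_b1_of_le hC2 hC1 hs' hle hLs' hω') hLs heven hadd
  linarith

/-- **ELECTRON-DOPED `t'`-face WINDOW, `β' ≥ 1`**: `e ∈ [−0.7845478090, 1.1313334043]` (lower edge kernel, upper edge conditional).
[cite: LiebWuPhysicaA2003, §1 eq. (3)] [cite: Ruelle1969, §3.4] -/
theorem thermal_n9o8_tpbox_window_b1_PH_of_le (hC2 : cert_c2sector_tp1o4_3x3_b1_j273931) (hC1 : cert_feC1_3x2_b1o4_j262363) {s : ℝ}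
    (hs : s ∈ Set.Icc (-3 / 10 : ℝ) (-1 / 5)) {β : ℝ} (hle : (1 : ℝ) ≤ β) {ω : InfVolFermionState 2} {Ls : ℕ → ℕ}
    (hLs : Tendsto Ls atTop atTop) (h4 : ∀ᶠ j in atTop, 4 ∣ Ls j)
    (h : ω.IsTorusLimitOfMixture (sectorGibbsCount (9 / 8)) (fun L => sectorGibbsWeightTT' β 1 s 8 (9 / 8) L)
      (fun L => sectorGibbsVectorTT' 1 s 8 (9 / 8) L) Ls) :
    ω.meanEnergy (hubbardTTPrimeFermionInteraction 1 s 8) 1 ∈ Set.Icc (-0.7845478090 : ℝ) 1.1313334043 := by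
  refine ⟨?_, thermal_n9o8_tpbox_upper_b1_PH_of_le hC2 hC1 hs hle hLs h4 h⟩
  have hl := thermal_n9o8_tpbox_lower (U := 8) (by norm_num) hs hLs h
  linarith

/-- **ELECTRON-DOPED `t'`-face cap, `β' ≥ 5/4`** (T = 4t/5 and colder): for every `s ∈ [−3/10, −1/5]` and every torus limit of the canonical class at
`(1, s, 8, 9/8, β')` along `Ls` with `4 ∣ Ls j` eventually, `e_{Φ(1,s,8)}(ω) ≤ 1.0172886318` (image `t'`-box cap `0.0172886318` + 1).
Strength = C2(cert_c2sector_tp1o4_3x3_b5o4_j273931) ∧ C1(cert_feC1_3x2_b1o4_j262363) ∧ kernel theorems. [cite: LiebWuPhysicaA2003, §1 eq. (3)] [cite: Israel1979, Lemma II.3.1] -/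
theorem thermal_n9o8_tpbox_upper_b5o4_PH_of_le (hC2 : cert_c2sector_tp1o4_3x3_b5o4_j273931) (hC1 : cert_feC1_3x2_b1o4_j262363) {s : ℝ}
    (hs : s ∈ Set.Icc (-3 / 10 : ℝ) (-1 / 5)) {β : ℝ} (hle : (5 / 4 : ℝ) ≤ β) {ω : InfVolFermionState 2} {Ls : ℕ → ℕ}
    (hLs : Tendsto Ls atTop atTop) (h4 : ∀ᶠ j in atTop, 4 ∣ Ls j)
    (h : ω.IsTorusLimitOfMixture (sectorGibbsCount (9 / 8)) (fun L => sectorGibbsWeightTT' β 1 s 8 (9 / 8) L)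
      (fun L => sectorGibbsVectorTT' 1 s 8 (9 / 8) L) Ls) :
    ω.meanEnergy (hubbardTTPrimeFermionInteraction 1 s 8) 1 ≤ (1.0172886318 : ℝ) := by
  have heven : ∀ᶠ j in atTop, Even (Ls j) :=
    h4.mono fun j hj => even_iff_two_dvd.2 (dvd_trans (by norm_num) hj)
  have hadd : ∀ᶠ j in atTop, halfRectN (7 / 8) (Ls j) + halfRectN (9 / 8) (Ls j) = Ls j ^ 2 :=
    h4.mono fun j hj => by
      have h' := halfRectN_compl_nine_eighths hj
      rwa [show (2 - 9 / 8 : ℝ) = 7 / 8 by norm_num] at h'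
  have hs' : -s ∈ Set.Icc (1 / 5 : ℝ) (3 / 10) := ⟨by linarith [hs.2], by linarith [hs.1]⟩
  have hmain := h.meanEnergy_le_of_forall_image_cap β 1 s 8 (s' := -s) (n' := 7 / 8) rfl (by norm_num) (by norm_num) (by norm_num)
    (fun Ls' ω' hLs' hω' => image_tpbox_p1o5_p3o10_upper_b5o4_of_le hC2 hC1 hs' hle hLs' hω') hLs heven hadd
  linarith

/-- **ELECTRON-DOPED `t'`-face WINDOW, `β' ≥ 5/4`**: `e ∈ [−0.7845478090, 1.0172886318]` (lower edge kernel, upper edge conditional).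
[cite: LiebWuPhysicaA2003, §1 eq. (3)] [cite: Ruelle1969, §3.4] -/
theorem thermal_n9o8_tpbox_window_b5o4_PH_of_le (hC2 : cert_c2sector_tp1o4_3x3_b5o4_j273931) (hC1 : cert_feC1_3x2_b1o4_j262363) {s : ℝ}
    (hs : s ∈ Set.Icc (-3 / 10 : ℝ) (-1 / 5)) {β : ℝ} (hle : (5 / 4 : ℝ) ≤ β) {ω : InfVolFermionState 2} {Ls : ℕ → ℕ}
    (hLs : Tendsto Ls atTop atTop) (h4 : ∀ᶠ j in atTop, 4 ∣ Ls j)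
    (h : ω.IsTorusLimitOfMixture (sectorGibbsCount (9 / 8)) (fun L => sectorGibbsWeightTT' β 1 s 8 (9 / 8) L)
      (fun L => sectorGibbsVectorTT' 1 s 8 (9 / 8) L) Ls) :
    ω.meanEnergy (hubbardTTPrimeFermionInteraction 1 s 8) 1 ∈ Set.Icc (-0.7845478090 : ℝ) 1.0172886318 := by
  refine ⟨?_, thermal_n9o8_tpbox_upper_b5o4_PH_of_le hC2 hC1 hs hle hLs h4 h⟩
  have hl := thermal_n9o8_tpbox_lower (U := 8) (by norm_num) hs hLs h
  linarith

/-- **ELECTRON-DOPED `t'`-face cap, `β' ≥ 3/2`** (T = 2t/3 and colder): for every `s ∈ [−3/10, −1/5]` and every torus limit of the canonical class at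
`(1, s, 8, 9/8, β')` along `Ls` with `4 ∣ Ls j` eventually, `e_{Φ(1,s,8)}(ω) ≤ 0.9421801550` (image `t'`-box cap `-0.0578198450` + 1).
Strength = C2(cert_c2sector_tp1o4_3x3_b3o2_j273931) ∧ C1(cert_feC1_3x2_b1o4_j262363) ∧ kernel theorems. [cite: LiebWuPhysicaA2003, §1 eq. (3)] [cite: Israel1979, Lemma II.3.1] -/
theorem thermal_n9o8_tpbox_upper_b3o2_PH_of_le (hC2 : cert_c2sector_tp1o4_3x3_b3o2_j273931) (hC1 : cert_feC1_3x2_b1o4_j262363) {s : ℝ}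
    (hs : s ∈ Set.Icc (-3 / 10 : ℝ) (-1 / 5)) {β : ℝ} (hle : (3 / 2 : ℝ) ≤ β) {ω : InfVolFermionState 2} {Ls : ℕ → ℕ}
    (hLs : Tendsto Ls atTop atTop) (h4 : ∀ᶠ j in atTop, 4 ∣ Ls j)
    (h : ω.IsTorusLimitOfMixture (sectorGibbsCount (9 / 8)) (fun L => sectorGibbsWeightTT' β 1 s 8 (9 / 8) L)
      (fun L => sectorGibbsVectorTT' 1 s 8 (9 / 8) L) Ls) :
    ω.meanEnergy (hubbardTTPrimeFermionInteraction 1 s 8) 1 ≤ (0.9421801550 : ℝ) := by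
  have heven : ∀ᶠ j in atTop, Even (Ls j) :=
    h4.mono fun j hj => even_iff_two_dvd.2 (dvd_trans (by norm_num) hj)
  have hadd : ∀ᶠ j in atTop, halfRectN (7 / 8) (Ls j) + halfRectN (9 / 8) (Ls j) = Ls j ^ 2 :=
    h4.mono fun j hj => by
      have h' := halfRectN_compl_nine_eighths hj
      rwa [show (2 - 9 / 8 : ℝ) = 7 / 8 by norm_num] at h'
  have hs' : -s ∈ Set.Icc (1 / 5 : ℝ) (3 / 10) := ⟨by linarith [hs.2], by linarith [hs.1]⟩
  have hmain := h.meanEnergy_le_of_forall_image_cap β 1 s 8 (s' := -s) (n' := 7 / 8) rfl (by norm_num) (by norm_num) (by norm_num)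
    (fun Ls' ω' hLs' hω' => image_tpbox_p1o5_p3o10_upper_b3o2_of_le hC2 hC1 hs' hle hLs' hω') hLs heven hadd
  linarith

/-- **ELECTRON-DOPED `t'`-face WINDOW, `β' ≥ 3/2`**: `e ∈ [−0.7845478090, 0.9421801550]` (lower edge kernel, upper edge conditional).
[cite: LiebWuPhysicaA2003, §1 eq. (3)] [cite: Ruelle1969, §3.4] -/
theorem thermal_n9o8_tpbox_window_b3o2_PH_of_le (hC2 : cert_c2sector_tp1o4_3x3_b3o2_j273931) (hC1 : cert_feC1_3x2_b1o4_j262363) {s : ℝ}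
    (hs : s ∈ Set.Icc (-3 / 10 : ℝ) (-1 / 5)) {β : ℝ} (hle : (3 / 2 : ℝ) ≤ β) {ω : InfVolFermionState 2} {Ls : ℕ → ℕ}
    (hLs : Tendsto Ls atTop atTop) (h4 : ∀ᶠ j in atTop, 4 ∣ Ls j)
    (h : ω.IsTorusLimitOfMixture (sectorGibbsCount (9 / 8)) (fun L => sectorGibbsWeightTT' β 1 s 8 (9 / 8) L)
      (fun L => sectorGibbsVectorTT' 1 s 8 (9 / 8) L) Ls) :
    ω.meanEnergy (hubbardTTPrimeFermionInteraction 1 s 8) 1 ∈ Set.Icc (-0.7845478090 : ℝ) 0.9421801550 := by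
  refine ⟨?_, thermal_n9o8_tpbox_upper_b3o2_PH_of_le hC2 hC1 hs hle hLs h4 h⟩
  have hl := thermal_n9o8_tpbox_lower (U := 8) (by norm_num) hs hLs h
  linarith

/-- **ELECTRON-DOPED `t'`-face cap, `β' ≥ 2`** (T = t/2 and colder): for every `s ∈ [−3/10, −1/5]` and every torus limit of the canonical class at
`(1, s, 8, 9/8, β')` along `Ls` with `4 ∣ Ls j` eventually, `e_{Φ(1,s,8)}(ω) ≤ 0.8464499976` (image `t'`-box cap `-0.1535500024` + 1).
Strength = C2(cert_c2sector_tp1o4_3x3_b2_j273931) ∧ C1(cert_feC1_3x2_b1o4_j262363) ∧ kernel theorems. [cite: LiebWuPhysicaA2003, §1 eq. (3)] [cite: Israel1979, Lemma II.3.1] -/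
theorem thermal_n9o8_tpbox_upper_b2_PH_of_le (hC2 : cert_c2sector_tp1o4_3x3_b2_j273931) (hC1 : cert_feC1_3x2_b1o4_j262363) {s : ℝ}
    (hs : s ∈ Set.Icc (-3 / 10 : ℝ) (-1 / 5)) {β : ℝ} (hle : (2 : ℝ) ≤ β) {ω : InfVolFermionState 2} {Ls : ℕ → ℕ}
    (hLs : Tendsto Ls atTop atTop) (h4 : ∀ᶠ j in atTop, 4 ∣ Ls j)
    (h : ω.IsTorusLimitOfMixture (sectorGibbsCount (9 / 8)) (fun L => sectorGibbsWeightTT' β 1 s 8 (9 / 8) L)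
      (fun L => sectorGibbsVectorTT' 1 s 8 (9 / 8) L) Ls) :
    ω.meanEnergy (hubbardTTPrimeFermionInteraction 1 s 8) 1 ≤ (0.8464499976 : ℝ) := by
  have heven : ∀ᶠ j in atTop, Even (Ls j) :=
    h4.mono fun j hj => even_iff_two_dvd.2 (dvd_trans (by norm_num) hj)
  have hadd : ∀ᶠ j in atTop, halfRectN (7 / 8) (Ls j) + halfRectN (9 / 8) (Ls j) = Ls j ^ 2 :=
    h4.mono fun j hj => by
      have h' := halfRectN_compl_nine_eighths hj
      rwa [show (2 - 9 / 8 : ℝ) = 7 / 8 by norm_num] at h'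
  have hs' : -s ∈ Set.Icc (1 / 5 : ℝ) (3 / 10) := ⟨by linarith [hs.2], by linarith [hs.1]⟩
  have hmain := h.meanEnergy_le_of_forall_image_cap β 1 s 8 (s' := -s) (n' := 7 / 8) rfl (by norm_num) (by norm_num) (by norm_num)
    (fun Ls' ω' hLs' hω' => image_tpbox_p1o5_p3o10_upper_b2_of_le hC2 hC1 hs' hle hLs' hω') hLs heven hadd
  linarith

/-- **ELECTRON-DOPED `t'`-face WINDOW, `β' ≥ 2`**: `e ∈ [−0.7845478090, 0.8464499976]` (lower edge kernel, upper edge conditional).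
[cite: LiebWuPhysicaA2003, §1 eq. (3)] [cite: Ruelle1969, §3.4] -/
theorem thermal_n9o8_tpbox_window_b2_PH_of_le (hC2 : cert_c2sector_tp1o4_3x3_b2_j273931) (hC1 : cert_feC1_3x2_b1o4_j262363) {s : ℝ}
    (hs : s ∈ Set.Icc (-3 / 10 : ℝ) (-1 / 5)) {β : ℝ} (hle : (2 : ℝ) ≤ β) {ω : InfVolFermionState 2} {Ls : ℕ → ℕ}
    (hLs : Tendsto Ls atTop atTop) (h4 : ∀ᶠ j in atTop, 4 ∣ Ls j)
    (h : ω.IsTorusLimitOfMixture (sectorGibbsCount (9 / 8)) (fun L => sectorGibbsWeightTT' β 1 s 8 (9 / 8) L)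
      (fun L => sectorGibbsVectorTT' 1 s 8 (9 / 8) L) Ls) :
    ω.meanEnergy (hubbardTTPrimeFermionInteraction 1 s 8) 1 ∈ Set.Icc (-0.7845478090 : ℝ) 0.8464499976 := by
  refine ⟨?_, thermal_n9o8_tpbox_upper_b2_PH_of_le hC2 hC1 hs hle hLs h4 h⟩
  have hl := thermal_n9o8_tpbox_lower (U := 8) (by norm_num) hs hLs h
  linarith

/-- **ELECTRON-DOPED `t'`-face cap, `β' ≥ 3`** (T = t/3 and colder): for every `s ∈ [−3/10, −1/5]` and every torus limit of the canonical class at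
`(1, s, 8, 9/8, β')` along `Ls` with `4 ∣ Ls j` eventually, `e_{Φ(1,s,8)}(ω) ≤ 0.7498266510` (image `t'`-box cap `-0.2501733490` + 1).
Strength = C2(cert_c2sector_tp1o4_3x3_b3_j273931) ∧ C1(cert_feC1_3x2_b3o8_j263703) ∧ kernel theorems. [cite: LiebWuPhysicaA2003, §1 eq. (3)] [cite: Israel1979, Lemma II.3.1] -/
theorem thermal_n9o8_tpbox_upper_b3_PH_of_le (hC2 : cert_c2sector_tp1o4_3x3_b3_j273931) (hC1 : cert_feC1_3x2_b3o8_j263703) {s : ℝ}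
    (hs : s ∈ Set.Icc (-3 / 10 : ℝ) (-1 / 5)) {β : ℝ} (hle : (3 : ℝ) ≤ β) {ω : InfVolFermionState 2} {Ls : ℕ → ℕ}
    (hLs : Tendsto Ls atTop atTop) (h4 : ∀ᶠ j in atTop, 4 ∣ Ls j)
    (h : ω.IsTorusLimitOfMixture (sectorGibbsCount (9 / 8)) (fun L => sectorGibbsWeightTT' β 1 s 8 (9 / 8) L)
      (fun L => sectorGibbsVectorTT' 1 s 8 (9 / 8) L) Ls) :
    ω.meanEnergy (hubbardTTPrimeFermionInteraction 1 s 8) 1 ≤ (0.7498266510 : ℝ) := by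
  have heven : ∀ᶠ j in atTop, Even (Ls j) :=
    h4.mono fun j hj => even_iff_two_dvd.2 (dvd_trans (by norm_num) hj)
  have hadd : ∀ᶠ j in atTop, halfRectN (7 / 8) (Ls j) + halfRectN (9 / 8) (Ls j) = Ls j ^ 2 :=
    h4.mono fun j hj => by
      have h' := halfRectN_compl_nine_eighths hj
      rwa [show (2 - 9 / 8 : ℝ) = 7 / 8 by norm_num] at h'
  have hs' : -s ∈ Set.Icc (1 / 5 : ℝ) (3 / 10) := ⟨by linarith [hs.2], by linarith [hs.1]⟩
  have hmain := h.meanEnergy_le_of_forall_image_cap β 1 s 8 (s' := -s) (n' := 7 / 8) rfl (by norm_num) (by norm_num) (by norm_num)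
    (fun Ls' ω' hLs' hω' => image_tpbox_p1o5_p3o10_upper_b3_of_le hC2 hC1 hs' hle hLs' hω') hLs heven hadd
  linarith

/-- **ELECTRON-DOPED `t'`-face WINDOW, `β' ≥ 3`**: `e ∈ [−0.7845478090, 0.7498266510]` (lower edge kernel, upper edge conditional).
[cite: LiebWuPhysicaA2003, §1 eq. (3)] [cite: Ruelle1969, §3.4] -/
theorem thermal_n9o8_tpbox_window_b3_PH_of_le (hC2 : cert_c2sector_tp1o4_3x3_b3_j273931) (hC1 : cert_feC1_3x2_b3o8_j263703) {s : ℝ}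
    (hs : s ∈ Set.Icc (-3 / 10 : ℝ) (-1 / 5)) {β : ℝ} (hle : (3 : ℝ) ≤ β) {ω : InfVolFermionState 2} {Ls : ℕ → ℕ}
    (hLs : Tendsto Ls atTop atTop) (h4 : ∀ᶠ j in atTop, 4 ∣ Ls j)
    (h : ω.IsTorusLimitOfMixture (sectorGibbsCount (9 / 8)) (fun L => sectorGibbsWeightTT' β 1 s 8 (9 / 8) L)
      (fun L => sectorGibbsVectorTT' 1 s 8 (9 / 8) L) Ls) :
    ω.meanEnergy (hubbardTTPrimeFermionInteraction 1 s 8) 1 ∈ Set.Icc (-0.7845478090 : ℝ) 0.7498266510 := by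
  refine ⟨?_, thermal_n9o8_tpbox_upper_b3_PH_of_le hC2 hC1 hs hle hLs h4 h⟩
  have hl := thermal_n9o8_tpbox_lower (U := 8) (by norm_num) hs hLs h
  linarith

end Summit.Ventures.CertifiedManyBodySolver.Certificates

end
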